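import Literature.Topology.FourManifolds.LinkingNumber
import Literature.Topology.FourManifolds.KirbyMovesReverseProofs
import HarnessLib

/-!
# Reversing a knot negates the linking number: discharge of `HasLinkingNumber.reverse_right`

Second sibling proof file of `LinkingNumber.lean` (next to `LinkingNumberProofs.lean`; D-0014: named facts `def X : Prop` are discharged as
`theorem X_holds : X`). It discharges

* `Literature.Knot.HasLinkingNumber.reverse_right_holds : HasLinkingNumber.reverse_right` —
  **`lk(K, rJ) = -lk(K, J)`**: if the class of the loop `J` in `π₁(S³ ∖ K)ᵃᵇ` is `l` times the
  class of the meridian of `K`, then the class of the loop of the reversed knot `J.reverse` is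
  `(-l)` times it.

Source: Rolfsen, *Knots and Links* (1976), §5.D, remark after Thm 5.D.1 (the linking number
changes sign when one of the two knots is reversed). Proof: the loop `θ ↦ rJ (e^{2πiθ}) =
J (e^{-2πiθ})` of the reversed knot is the reversed loop of `J` (`loopInCompl_reverse`, using
`reflectLast 1 (circlePoint s) = circlePoint (-s)` of `KirbyMovesReverseProofs.lean`), with the
same base point `J (1, 0)`; conjugating by the same path `γ` from the base point of the tubular
neighbourhood, `γ · J⁻¹ · γ⁻¹ ≃ (γ · J · γ⁻¹)⁻¹` (reassociation, `Path.Homotopy.transAssoc`), so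
its image in the abelianisation is `(l • [μ])⁻¹ = (-l) • [μ]`.

## References

* D. Rolfsen, *Knots and Links*, Publish or Perish (1976), §5.D, Thm 5.D.1 and the remark
  following it. [cite: Rolfsen1976, §5.D Thm 5.D.1]
-/

open scoped Manifold ContDiff Topology
open Function Set

noncomputable section

namespace Literature.Topology.FourManifolds

/-- Local notation: `𝕊 n` is the unit sphere in `EuclideanSpace ℝ (Fin (n + 1))`. -/
local notation "𝕊 " n:arg => (Metric.sphere (0 : EuclideanSpace ℝ (Fin (n + 1))) 1)

namespace Knot

/-- The reversed knot at `circlePoint s` is the knot at `circlePoint (-s)`. [folklore] -/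
theorem reverse_apply_circlePoint (J : Knot) (s : ℝ) : J.reverse (circlePoint s) = J (circlePoint (-s)) := by
  rw [SphereEmbedding.coe_reverse, comp_apply, reflectLast_circlePoint]

/-- The reversed knot has the same base point `rJ (1, 0) = J (1, 0)`. [folklore] -/
theorem reverse_apply_circlePoint_zero (J : Knot) : J.reverse (circlePoint 0) = J (circlePoint 0) := by
  rw [reverse_apply_circlePoint, neg_zero]

/-- **The loop of the reversed knot is the reversed loop** (in the complement of `K`, cast to the
common base point). [folklore] -/
theorem loopInCompl_reverse (K J : Knot) (h : Disjoint (range ⇑K) (range ⇑J))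
    (hb : (⟨J.reverse (circlePoint 0), mem_complement_of_disjoint (disjoint_range_reverse h) _⟩ :
      K.complement) = ⟨J (circlePoint 0), mem_complement_of_disjoint h _⟩) :
    K.loopInCompl J.reverse (disjoint_range_reverse h) = ((K.loopInCompl J h).symm).cast hb hb := by
  apply Path.ext
  funext t
  apply Subtype.ext
  change J.reverse (circlePoint (2 * Real.pi * t)) =
    J (circlePoint (2 * Real.pi * (unitInterval.symm t : ℝ)))
  rw [reverse_apply_circlePoint, unitInterval.coe_symm_eq,
    TubularNbhd.circlePoint_two_pi_mul_one_sub]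

/-- Conjugates of inverse loops: in the fundamental group, `[γ · L⁻¹ · γ⁻¹] = [γ · L · γ⁻¹]⁻¹`.
[folklore] -/
theorem fromPath_conj_symm {X : Type*} [TopologicalSpace X] {x y : X} (γ : Path x y) (L : Path y y) :
    FundamentalGroup.fromPath (Path.Homotopic.Quotient.mk ((γ.trans L.symm).trans γ.symm)) =
      (FundamentalGroup.fromPath (Path.Homotopic.Quotient.mk ((γ.trans L).trans γ.symm)))⁻¹ := by
  rw [FundamentalGroup.inv_def, ← Path.Homotopic.Quotient.mk_symm, Path.trans_symm, Path.trans_symm,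
    Path.symm_symm]
  exact Quotient.sound ⟨Path.Homotopy.transAssoc γ L.symm γ.symm⟩

/-- **Reversing the second knot negates the linking number**, for one pair of knots: if
`lk(K, J) = l` then `lk(K, rJ) = -l`. Rolfsen (1976), §5.D, remark after Thm 5.D.1.
[cite: Rolfsen1976, §5.D Thm 5.D.1] -/
theorem HasLinkingNumber.reverse_right' {K J : Knot} {h : Disjoint (range ⇑K) (range ⇑J)} {l : ℤ}
    (hl : K.HasLinkingNumber J h l) :
    K.HasLinkingNumber J.reverse (disjoint_range_reverse h) (-l) := by
  obtain ⟨ν, γ, hγ⟩ := hl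
  have hb : (⟨J.reverse (circlePoint 0), mem_complement_of_disjoint (disjoint_range_reverse h) _⟩ :
      K.complement) = ⟨J (circlePoint 0), mem_complement_of_disjoint h _⟩ :=
    Subtype.ext (reverse_apply_circlePoint_zero J)
  refine ⟨ν, γ.cast rfl hb, ?_⟩
  have hpath : ((γ.cast rfl hb).trans (K.loopInCompl J.reverse (disjoint_range_reverse h))).trans
      (γ.cast rfl hb).symm = (γ.trans (K.loopInCompl J h).symm).trans γ.symm := by
    rw [loopInCompl_reverse K J h hb]
    apply Path.ext
    funext t
    rfl
  rw [hpath, fromPath_conj_symm, map_inv, hγ, ← zpow_neg]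

/-- Discharge of the named fact `HasLinkingNumber.reverse_right` (`LinkingNumber.lean`):
**`lk(K, rJ) = -lk(K, J)`**. Rolfsen (1976), §5.D, remark after Thm 5.D.1.
[cite: Rolfsen1976, §5.D Thm 5.D.1] -/
theorem HasLinkingNumber.reverse_right_holds : HasLinkingNumber.reverse_right :=
  fun hl ↦ hl.reverse_right'

end Knot

end Literature.Topology.FourManifolds
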